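import Literature.MathematicalPhysics.QuantumFieldTheory.Balaban1983to89.B1Ineq234Concrete

/-!
# `Balaban1983to89.B1Ineq234LevelZero` — T. Bałaban, *(Higgs)₂,₃ quantum fields in a finite volume. I. A lower bound*,
# Commun. Math. Phys. **85** (1982) 603–626 [Balaban1982Higgs1], Proposition 2.3 p. 611–612: **(2.34) AND (2.36) AT THE
# FIRST LEVEL `k = 0` FOR THE CONCRETE (Higgs)₂,₃ OPERATORS, PROVED FOR EVERY EXTERNAL FIELD `A`, EVERY `Ω`, EVERY `Λ`
# AND EVERY TORUS** — at `k = 0` the operator `a(Lε)^{−2}P(A) + Δ^{(0),ε}(Ω, A) = a(Lε)^{−2}P(A) − Δ^{ε,N}_{A,Ω} + m²`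
# ((2.30) with (2.17)) is LOCAL (nearest-neighbour kernel) and `≥ m²`, so the two inputs of [B4] §5 — the lower bound
# (5.6)/(2.33)ₗ and the short-range bound (5.4) — hold outright, and `B1Ineq234Concrete.ineq234_concrete`/`ineq236_concrete`
# ((5.7)/(5.8) ⇒ (2.34)/(2.36)) apply with no hypothesis left

statement-level skeleton of published theorems with citation tags; proofs where landed; nothing here is a claim about the Yang–Mills mass gap

PDFs held: `paper:balaban1982-cmp85-higgs23-i` (journal page = PDF page + 602), pp. 604–605 [PDF 2–3], pp. 610–612 [PDF 8–10];
`paper:balaban1983-cmp89-regularity-decay` (journal page = PDF page + 570), pp. 593–594 [PDF 23–24] — read on the ×2 renders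
under `run/shared/lean/pub/pub-balaban/b2b-balaban-ref1/pages/`.

CITATION HEADER (lean-in-tree rule).  Cell `lit-balaban` (HOME `run/shared/lean/pub/lit-balaban/`), seat **r14** gen 7
(reader/typer of B1/B2, fold owner of SKELETON row **B1.Prop2.3**; unit `lit-balaban-r14-g7`).  WHAT IS REPRODUCED: row
B1.Prop2.3, members (2.34)/(2.36), kind «model instance on the concrete carrier, first level»: the decls of record
`B1.Prop23Literal` / `B1.Prop23Intended` (pv07) are UNTOUCHED; this file composes BY NAME the concrete route of
`B1Ineq234Concrete` (r14 g7: [B4] §5 Theorem `B4Sect5Torus.sect5_uniform` for p35's `precOpA`/the typer's `condCov232`,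
`deltaCov235`) with two facts about the level-`0` operator proved here.  Nothing is redefined; no definition in this file.

WHAT IS PRINTED.  B1 p. 611 [PDF 9]: *"Proposition 2.3. If a configuration A is regular on Ω …, then there exist positive
constants δ₀, c₀, γ₀, γ₁, dependent on d and a, and independent of A, k, Ω and Λ, such that … |C^{(k)}_Λ(Ω, A; y, y′)| ≦
c₀ exp(−δ₀|y − y′|), y, y′ ∈ Λ. (2.34)"*; p. 612: *"|δC^{(k)}_Λ(Ω, A; y, y′)| ≦ c₀ exp(−δ₀(dist(y, Λᶜ) + |y − y′| +
dist(y′, Λᶜ))) (2.36)"*; p. 610 (2.17): *"Δ^{(0),ε}(Ω, A) = −Δ^{ε,N}_{A,Ω} + m²"*; p. 605 (1.11): the covariant Laplacian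
couples nearest neighbours only, `(D^η_Aφ)(b) = η^{−1}(U(A_b)φ(b₊) − φ(b₋))`.  [Balaban1983RegularityDecay] p. 594 (5.4):
*"|(aL^{−2}P(A) + Δ^{(k)}(Ω,A))(x, x′)| ≦ c₀ exp(−δ₀|x − x′|)"*; p. 593 (5.6) the form lower bound; p. 594 (5.7)/(5.8) the
conclusions (2.34)/(2.36) *"with constants … depending only on γ₀, c₀, δ₀ and d"*.

WHAT THIS FILE PROVES (kernel-checked, zero `sorry`, standard axioms; theorems only):
* §1 one lattice step has (1.3)-length `≤ 1`: `tdist_shift_le_one`, `tdist_unshift_le_one` (every level).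
* §2 LOCALITY of `−Δ^{η,N}_{A,Ω}` (every level, every `A`, `Ω`): `fwdTerm_cb_eq_zero`, `bwdTerm_cb_eq_zero`,
  `covLaplacianN_apply`, `covLaplacianN_cb_apply_eq_zero` (`(−Δ e_q)(x) = 0` unless `x` is `x_q` or a neighbour of it),
  `mat_deltaKA_zero_eq_zero` (`Δ^{(0),ε}(Ω,A)(p, q) = 0` if `|x_p − x_q| > 1`).
* §3 SIZE: `abs_mat_deltaKA_zero_le_const` (`|Δ^{(0),ε}(Ω,A)(p,q)| ≤ 4dε^{−2} + m²`, from `m² ≤ Δ^{(0)} ≤ 4dε^{−2} + m²` by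
  polarisation, `m² ≥ 0`) ⇒ **(5.4) at level `0` for every `A`, `Ω`, every rate `δ ≥ 0`**: `abs_mat_deltaKA_zero_le`
  (`|Δ^{(0)}(p,q)| ≤ (4dε^{−2} + m²)e^{δ}e^{−δ|x_p−x_q|}`), `hker_precOpA_levelZero` (adding the `P(A)`-part of
  `B1Ineq234Concrete.hker_precOpA_of_deltaKA`).
* §4 **(2.33) lower half at level `0` for every `A`, `Ω` with `γ₀ = m²`**: `lower_precOpA_levelZero`
  (`m²‖f‖² ≤ ⟨f, (a(Lε)^{−2}P(A) + Δ^{(0),ε}(Ω,A))f⟩`, `a ≥ 0`).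
* §5 **`ineq234_levelZero` / `ineq236_levelZero`**: for `m² > 0`, `a ≥ 0`, `0 < K`, EVERY external field `A` (no regularity
  needed at `k = 0`), every `Ω ⊂ T_ε`, every `Λ ⊂ T_ε`, every charge data and every torus of the model,
  `|C^{(0),ε}_Λ(Ω, A; p, q)| ≤ c₁e^{−δ₁|x_p − x_q|}` and `|δC^{(0),ε}_Λ(Ω, A; p, q)| ≤ c₁e^{−δ₁(dist(x_p,Λᶜ) + |x_p − x_q| +
  dist(x_q,Λᶜ))}` on `Λ`, `(c₁, δ₁) = (cSt, dSt)(N·K_d; m², c₀(δ), δ)` for every `δ > 0`,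
  `c₀(δ) = a(Lε)^{−2}e^{δ(L−1)} + (4dε^{−2} + m²)e^{δ}` — distances in lattice units of `T_ε`.
* §6 (v1.1) **`ineq238_levelZero`**: (2.37)–(2.38) at level `0` for `Ω ⊂ Ω₀`, every `A`, `Λ`:
  `|(C^{(0),ε}_Λ(Ω,A) − C^{(0),ε}_Λ(Ω₀,A))(p, q)| ≤ c₁e^{−δ₁(|x_p − x_q| + dist(x_p,Ωᶜ) + dist(x_q,Ωᶜ))}` with
  `(c₁, δ₁) = (cSt, dSt)(N·K_d; m², c(δ), δ)`, `c(δ) = a(Lε)^{−2}e^{δ(L−1)} + (4dε^{−2} + m²)(e^{δ} + 2e^{3δ})`, from the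
  localisation input (5.5) PROVED at level `0` (`abs_mat_deltaKA_zero_sub_le`: the difference of the two Neumann
  Laplacians lives within distance `1` of `Ωᶜ` — `covLaplacianN_apply_eq_of_interior`,
  `mat_deltaKA_zero_sub_eq_zero_of_interior`) and the `1`-Lipschitz boundary weight `dist(·, Ωᶜ)` (`distC_le_tdist_add`,
  via `tdist_triangle_real`), through `B1Ineq234Concrete.ineq238_concrete` BY NAME.
HONEST SCOPE.  (i) Level `k = 0` only (the local case); `k ≥ 1` needs [B4] Prop. II.3.1′ / Cor. 2.3 (`B1Ineq234Concrete`
§4–§5 reduce (2.34)/(2.36) to them).  (ii) The constants are explicit but NOT the printed "dependent on d and a only": they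
carry `m²`, `N`, `L` and the lattice spacing (`ε^{−2}` in `c₀`; on the unit lattice `ε = 1` they are absolute); no
optimisation in `δ`.  (iii) `Λ` an arbitrary finite set of sites (the print: unions of big blocks); in §6 the weight is `dist(·, Ωᶜ)` on `T_ε` (the print's `Ω^{(0)c}`).  (iv) Value = kernel
certificate that the printed decay holds for the concrete first-level conditional covariances, unconditionally; NOT summit
progress.  Unit `lit-balaban-r14-g7` (literature-prover-lit-balaban-r14-g7-0); HOME/FILED.md records the proposal.
-/

open scoped BigOperators InnerProductSpace

namespace Literature.MathematicalPhysics.QuantumFieldTheory.Balaban1983to89.B1Ineq234LevelZero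

open HiggsLattice HiggsCovariance HiggsCovariancePos B1Eq221Coordinates B1Eq230FluctCov B1Eq230FluctCovPos HiggsCondCov232
open HiggsFluctMeasurePos (siteInner_add_right siteInner_smul_right)
open B1Ineq233Upper (siteInner_deltaKA_zero_le)
open B1Ineq234Concrete (profile distC distC_nonneg distC_le cb_apply_of_ne mat_apply abs_mat_le_of_form_bounds mat_isSymm
  hker_precOpA_of_deltaKA tdist_self sdist_eq_tdist one_le_periods ineq234_concrete ineq236_concrete ineq238_concrete)
open B4Sect5Torus (cSt dSt)

variable {P : HiggsLattice.Params} {N : ℕ} {k : ℕ}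

/-! ## §1 One lattice step has length `≤ 1` in the distance (1.3) -/

/-- `|x − (x + L^kε e_μ)| ≤ 1` in lattice units (`= 1` unless the period is `1`). [cite: Balaban1982Higgs1, (1.3) p.604] -/
theorem tdist_shift_le_one (x : HiggsLattice.Site P k) (μ : Fin P.d) :
    HiggsLattice.Site.tdist x (x.shift μ) ≤ 1 := by
  unfold HiggsLattice.Site.tdist
  refine Finset.sup_le fun ν _ => ?_
  by_cases hν : ν = μ
  · subst hν
    calc min (x ν - x.shift ν ν).val (x.shift ν ν - x ν).val ≤ (x.shift ν ν - x ν).val := min_le_right _ _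
      _ = (1 : ZMod (P.sitesPerDir k ν)).val := by rw [HiggsLattice.Site.shift, Function.update_self, add_sub_cancel_left]
      _ ≤ 1 := by rw [ZMod.val_one_eq_one_mod]; exact Nat.mod_le 1 _
  · have h : x.shift μ ν = x ν := by rw [HiggsLattice.Site.shift, Function.update_of_ne hν]
    rw [h, sub_self, ZMod.val_zero, min_self]
    exact Nat.zero_le 1

/-- `|x − (x − L^kε e_μ)| ≤ 1` in lattice units. [cite: Balaban1982Higgs1, (1.3) p.604] -/
theorem tdist_unshift_le_one (x : HiggsLattice.Site P k) (μ : Fin P.d) :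
    HiggsLattice.Site.tdist x (x.unshift μ) ≤ 1 := by
  unfold HiggsLattice.Site.tdist
  refine Finset.sup_le fun ν _ => ?_
  by_cases hν : ν = μ
  · subst hν
    calc min (x ν - x.unshift ν ν).val (x.unshift ν ν - x ν).val ≤ (x ν - x.unshift ν ν).val := min_le_left _ _
      _ = (1 : ZMod (P.sitesPerDir k ν)).val := by rw [HiggsLattice.Site.unshift, Function.update_self, sub_sub_cancel]
      _ ≤ 1 := by rw [ZMod.val_one_eq_one_mod]; exact Nat.mod_le 1 _
  · have h : x.unshift μ ν = x ν := by rw [HiggsLattice.Site.unshift, Function.update_of_ne hν]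
    rw [h, sub_self, ZMod.val_zero, min_self]
    exact Nat.zero_le 1

/-! ## §2 Locality of the covariant Neumann Laplacian -/

section Locality

variable (C : ChargeData N) (Ω : Finset (HiggsLattice.Site P k)) (A : HiggsLattice.VecField P k)

/-- The forward term at `x` in direction `μ` sees only `φ(x)` and `φ(x + ηe_μ)`: it kills a basis field `e_q` whose site is
neither. [cite: Balaban1982Higgs1, (1.11) p.605] -/
theorem fwdTerm_cb_eq_zero {q : HiggsLattice.Site P k × Ix N} {x : HiggsLattice.Site P k} {μ : Fin P.d} (hx : x ≠ q.1)
    (hμ : x.shift μ ≠ q.1) : fwdTerm C Ω A x μ (cb P N k q) = 0 := by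
  unfold fwdTerm
  split_ifs
  · simp [cb_apply_of_ne hx, cb_apply_of_ne hμ]
  · rfl

/-- The backward term at `x` in direction `μ` sees only `φ(x)` and `φ(x − ηe_μ)`. [cite: Balaban1982Higgs1, (1.11) p.605] -/
theorem bwdTerm_cb_eq_zero {q : HiggsLattice.Site P k × Ix N} {x : HiggsLattice.Site P k} {μ : Fin P.d} (hx : x ≠ q.1)
    (hμ : x.unshift μ ≠ q.1) : bwdTerm C Ω A x μ (cb P N k q) = 0 := by
  unfold bwdTerm
  split_ifs
  · simp [cb_apply_of_ne hx, cb_apply_of_ne hμ]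
  · rfl

/-- Pointwise form of the operator (1.11)/(2.17): `(−Δ^{η,N}_{A,Ω}φ)(x) = η^{−2}Σ_μ(forward + backward terms)`.
[cite: Balaban1982Higgs1, (1.11) p.605] -/
theorem covLaplacianN_apply (φ : ScalarField P k N) (x : HiggsLattice.Site P k) :
    covLaplacianN C Ω A φ x = ((P.mesh k)⁻¹ ^ 2) • ∑ μ : Fin P.d, (fwdTerm C Ω A x μ φ + bwdTerm C Ω A x μ φ) := by
  rw [covLaplacianN, LinearMap.pi_apply, LinearMap.smul_apply, LinearMap.sum_apply]
  rfl

/-- **Locality**: `(−Δ^{η,N}_{A,Ω}e_q)(x) = 0` unless `x = x_q` or `x ± ηe_μ = x_q` for some `μ` — every `A`, `Ω`, level.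
[cite: Balaban1982Higgs1, (1.11) p.605] -/
theorem covLaplacianN_cb_apply_eq_zero {q : HiggsLattice.Site P k × Ix N} {x : HiggsLattice.Site P k} (hx : x ≠ q.1)
    (hs : ∀ μ, x.shift μ ≠ q.1) (hu : ∀ μ, x.unshift μ ≠ q.1) : covLaplacianN C Ω A (cb P N k q) x = 0 := by
  rw [covLaplacianN_apply]
  have : ∑ μ : Fin P.d, (fwdTerm C Ω A x μ (cb P N k q) + bwdTerm C Ω A x μ (cb P N k q)) = 0 :=
    Finset.sum_eq_zero fun μ _ => by rw [fwdTerm_cb_eq_zero C Ω A hx (hs μ), bwdTerm_cb_eq_zero C Ω A hx (hu μ), add_zero]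
  rw [this, smul_zero]

/-- If `|x − x_q| > 1` then `x` is neither `x_q` nor a neighbour of it. [cite: Balaban1982Higgs1, (1.3) p.604] -/
theorem far_apart {x y : HiggsLattice.Site P k} (h : 1 < HiggsLattice.Site.tdist x y) :
    x ≠ y ∧ (∀ μ, x.shift μ ≠ y) ∧ (∀ μ, x.unshift μ ≠ y) := by
  refine ⟨fun hxy => ?_, fun μ hμ => ?_, fun μ hμ => ?_⟩
  · rw [hxy, tdist_self] at h
    exact Nat.not_lt_zero 1 h
  · rw [← hμ] at h
    exact absurd (tdist_shift_le_one x μ) (not_le.mpr h)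
  · rw [← hμ] at h
    exact absurd (tdist_unshift_le_one x μ) (not_le.mpr h)

end Locality

section LevelZero

variable (C : ChargeData N) (Ω : Finset (HiggsLattice.Site P 0)) (A : HiggsLattice.VecField P 0) (msq a : ℝ)

/-- **`Δ^{(0),ε}(Ω, A) = −Δ^{ε,N}_{A,Ω} + m²` has a nearest-neighbour kernel**: `Δ^{(0),ε}(Ω,A)(p, q) = 0` whenever
`|x_p − x_q| > 1` — every `A`, `Ω`, `m²`. [cite: Balaban1982Higgs1, (2.17) p.610] -/
theorem mat_deltaKA_zero_eq_zero {p q : HiggsLattice.Site P 0 × Ix N} (h : 1 < HiggsLattice.Site.tdist p.1 q.1) :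
    mat (deltaKA C Ω A msq a 0) p q = 0 := by
  obtain ⟨hx, hs, hu⟩ := far_apart h
  rw [mat_apply, fieldCoord_apply, deltaKA_zero, delta0, LinearMap.add_apply, LinearMap.smul_apply, LinearMap.id_apply,
    Pi.add_apply, Pi.smul_apply, covLaplacianN_cb_apply_eq_zero C Ω A hx hs hu, cb_apply_of_ne hx, smul_zero, add_zero,
    map_zero, Pi.zero_apply]

/-! ## §3 Size of the entries and (5.4) at level `0` -/

/-- **`|Δ^{(0),ε}(Ω,A)(p, q)| ≤ 4dε^{−2} + m²`** (`m² ≥ 0`), every `A`, `Ω`: polarisation of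
`m²‖f‖² ≤ ⟨f, Δ^{(0)}f⟩ ≤ (4dε^{−2} + m²)‖f‖²` (`B1Eq230FluctCovPos.siteInner_deltaKA_zero_ge`,
`B1Ineq233Upper.siteInner_deltaKA_zero_le`). [cite: Balaban1982Higgs1, (2.17) p.610] -/
theorem abs_mat_deltaKA_zero_le_const (hmsq : 0 ≤ msq) (p q : HiggsLattice.Site P 0 × Ix N) :
    |mat (deltaKA C Ω A msq a 0) p q| ≤ 4 * P.d * (P.mesh 0)⁻¹ ^ 2 + msq :=
  abs_mat_le_of_form_bounds (siteInner_deltaKA_comm C Ω A msq a 0)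
    (fun f => (mul_nonneg hmsq (siteInner_self_nonneg f)).trans (siteInner_deltaKA_zero_ge C Ω A msq a f))
    (fun f => siteInner_deltaKA_zero_le C Ω A msq a f) p q

/-- **(5.4) for `Δ^{(0),ε}(Ω, A)`, every `A`, `Ω`, every rate `δ ≥ 0`**:
`|Δ^{(0),ε}(Ω,A)(p, q)| ≤ (4dε^{−2} + m²)e^{δ}·e^{−δ|x_p − x_q|}` (`m² ≥ 0`). [cite: Balaban1983RegularityDecay, (5.4) p.594] -/
theorem abs_mat_deltaKA_zero_le (hmsq : 0 ≤ msq) {δ : ℝ} (hδ : 0 ≤ δ) (p q : HiggsLattice.Site P 0 × Ix N) :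
    |mat (deltaKA C Ω A msq a 0) p q| ≤
      (4 * P.d * (P.mesh 0)⁻¹ ^ 2 + msq) * Real.exp δ * Real.exp (-(δ * (HiggsLattice.Site.tdist p.1 q.1 : ℝ))) := by
  have hB : 0 ≤ 4 * (P.d : ℝ) * (P.mesh 0)⁻¹ ^ 2 + msq := by positivity
  by_cases h : HiggsLattice.Site.tdist p.1 q.1 ≤ 1
  · have ht : (HiggsLattice.Site.tdist p.1 q.1 : ℝ) ≤ 1 := by exact_mod_cast h
    calc |mat (deltaKA C Ω A msq a 0) p q| ≤ 4 * P.d * (P.mesh 0)⁻¹ ^ 2 + msq :=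
          abs_mat_deltaKA_zero_le_const C Ω A msq a hmsq p q
      _ = (4 * P.d * (P.mesh 0)⁻¹ ^ 2 + msq) * 1 := (mul_one _).symm
      _ ≤ (4 * P.d * (P.mesh 0)⁻¹ ^ 2 + msq) *
            (Real.exp δ * Real.exp (-(δ * (HiggsLattice.Site.tdist p.1 q.1 : ℝ)))) := by
          refine mul_le_mul_of_nonneg_left ?_ hB
          rw [← Real.exp_add]
          exact Real.one_le_exp (by nlinarith)
      _ = _ := by ring
  · rw [mat_deltaKA_zero_eq_zero C Ω A msq a (not_le.mp h), abs_zero]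
    positivity

/-- **(5.4) at level `0` for the whole precision operator `a(Lε)^{−2}P(A) + Δ^{(0),ε}(Ω, A)`**, every `A`, `Ω`, every rate
`δ ≥ 0` (`a ≥ 0`, `m² ≥ 0`, `0 < K`): `c₀(δ) = a(Lε)^{−2}e^{δ(L−1)} + (4dε^{−2} + m²)e^{δ}`.
[cite: Balaban1983RegularityDecay, (5.4) p.594] -/
theorem hker_precOpA_levelZero (hK : 0 < P.K) (ha : 0 ≤ a) (hmsq : 0 ≤ msq) {δ : ℝ} (hδ : 0 ≤ δ)
    (p q : HiggsLattice.Site P 0 × Ix N) :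
    |mat (precOpA C Ω A msq a 0) p q| ≤
      (a * ((P.mesh (0 + 1))⁻¹ ^ 2) * Real.exp (δ * ((P.L : ℝ) - 1)) +
          (4 * P.d * (P.mesh 0)⁻¹ ^ 2 + msq) * Real.exp δ) *
        Real.exp (-(δ * (HiggsLattice.Site.tdist p.1 q.1 : ℝ))) :=
  hker_precOpA_of_deltaKA C A Ω msq a hK ha hδ (fun p q => abs_mat_deltaKA_zero_le C Ω A msq a hmsq hδ p q) p q

/-! ## §4 The form lower bound at level `0` -/

/-- **(2.33) lower half at level `0` with `γ₀ = m²`, every `A`, `Ω`**: `m²‖f‖² ≤ ⟨f, (a(Lε)^{−2}P(A) + Δ^{(0),ε}(Ω,A))f⟩`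
(`P(A) ≥ 0`, `−Δ^{ε,N}_{A,Ω} ≥ 0`; `a ≥ 0`). [cite: Balaban1982Higgs1, Prop. 2.3 (2.33) p.611] -/
theorem lower_precOpA_levelZero (ha : 0 ≤ a) (f : ScalarField P 0 N) :
    msq * siteInner f f ≤ siteInner f (precOpA C Ω A msq a 0 f) := by
  rw [precOpA, LinearMap.add_apply, LinearMap.smul_apply, siteInner_add_right, siteInner_smul_right]
  have h1 : 0 ≤ siteInner f (blockProjA C A 0 f) := siteInner_blockProjA_nonneg C A 0 f
  have h2 := siteInner_deltaKA_zero_ge C Ω A msq a f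
  have h3 : 0 ≤ a * ((P.mesh (0 + 1))⁻¹ ^ 2) * siteInner f (blockProjA C A 0 f) :=
    mul_nonneg (mul_nonneg ha (sq_nonneg _)) h1
  linarith

/-! ## §5 (2.34) and (2.36) at level `0`, unconditionally -/

/-- The (5.4) constant at level `0` is positive (`m² > 0`). [cite: Balaban1983RegularityDecay, (5.4) p.594] -/
theorem kerConst_levelZero_pos (ha : 0 ≤ a) (hmsq : 0 < msq) (δ : ℝ) :
    0 < a * ((P.mesh (0 + 1))⁻¹ ^ 2) * Real.exp (δ * ((P.L : ℝ) - 1)) +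
      (4 * P.d * (P.mesh 0)⁻¹ ^ 2 + msq) * Real.exp δ :=
  add_pos_of_nonneg_of_pos (mul_nonneg (mul_nonneg ha (sq_nonneg _)) (Real.exp_pos _).le)
    (mul_pos (by positivity) (Real.exp_pos _))

/-- **(2.34) AT LEVEL `0`, PROVED FOR EVERY `A`, `Ω`, `Λ`**: for `m² > 0`, `a ≥ 0`, `0 < K`, every rate parameter
`δ > 0`, every external field `A`, every `Ω, Λ ⊂ T_ε` and `p, q` with sites in `Λ`,
`|C^{(0),ε}_Λ(Ω, A; p, q)| ≤ c₁e^{−δ₁|x_p − x_q|}`, `(c₁, δ₁) = (cSt, dSt)(N·K_d; m², c₀(δ), δ)`,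
`c₀(δ) = a(Lε)^{−2}e^{δ(L−1)} + (4dε^{−2} + m²)e^{δ}`. [cite: Balaban1982Higgs1, Prop. 2.3 (2.34) p.611] -/
theorem ineq234_levelZero (hK : 0 < P.K) (ha : 0 ≤ a) (hmsq : 0 < msq) {δ : ℝ} (hδ : 0 < δ)
    (Λ : Finset (HiggsLattice.Site P 0)) {p q : HiggsLattice.Site P 0 × Ix N} (hp : p.1 ∈ Λ) (hq : q.1 ∈ Λ) :
    |mat (condCov232 C Ω A msq a 0 Λ) p q| ≤
      cSt (profile P N) msq
          (a * ((P.mesh (0 + 1))⁻¹ ^ 2) * Real.exp (δ * ((P.L : ℝ) - 1)) +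
            (4 * P.d * (P.mesh 0)⁻¹ ^ 2 + msq) * Real.exp δ) δ *
        Real.exp (-(dSt (profile P N) msq
          (a * ((P.mesh (0 + 1))⁻¹ ^ 2) * Real.exp (δ * ((P.L : ℝ) - 1)) +
            (4 * P.d * (P.mesh 0)⁻¹ ^ 2 + msq) * Real.exp δ) δ *
          (HiggsLattice.Site.tdist p.1 q.1 : ℝ))) :=
  ineq234_concrete C Ω A msq a hmsq (kerConst_levelZero_pos msq a ha hmsq δ) hδ
    (fun f => lower_precOpA_levelZero C Ω A msq a ha f)
    (fun p q => hker_precOpA_levelZero C Ω A msq a hK ha hmsq.le hδ.le p q) Λ hp hq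

/-- **(2.36) AT LEVEL `0`, PROVED FOR EVERY `A`, `Ω`, `Λ`**: with the same data,
`|δC^{(0),ε}_Λ(Ω, A; p, q)| ≤ c₁e^{−δ₁(dist(x_p, Λᶜ) + |x_p − x_q| + dist(x_q, Λᶜ))}` on `Λ`
(`δC^{(0)}_Λ = C^{(0)}_Λ − C^{(0)}`, the typer's `deltaCov235`). [cite: Balaban1982Higgs1, Prop. 2.3 (2.36) p.612] -/
theorem ineq236_levelZero (hK : 0 < P.K) (ha : 0 ≤ a) (hmsq : 0 < msq) {δ : ℝ} (hδ : 0 < δ)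
    (Λ : Finset (HiggsLattice.Site P 0)) {p q : HiggsLattice.Site P 0 × Ix N} (hp : p.1 ∈ Λ) (hq : q.1 ∈ Λ) :
    |mat (deltaCov235 C Ω A msq a 0 Λ) p q| ≤
      cSt (profile P N) msq
          (a * ((P.mesh (0 + 1))⁻¹ ^ 2) * Real.exp (δ * ((P.L : ℝ) - 1)) +
            (4 * P.d * (P.mesh 0)⁻¹ ^ 2 + msq) * Real.exp δ) δ *
        Real.exp (-(dSt (profile P N) msq
          (a * ((P.mesh (0 + 1))⁻¹ ^ 2) * Real.exp (δ * ((P.L : ℝ) - 1)) +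
            (4 * P.d * (P.mesh 0)⁻¹ ^ 2 + msq) * Real.exp δ) δ *
          ((HiggsLattice.Site.tdist p.1 q.1 : ℝ) + distC Λ p.1 + distC Λ q.1))) :=
  ineq236_concrete C Ω A msq a hmsq (kerConst_levelZero_pos msq a ha hmsq δ) hδ
    (fun f => lower_precOpA_levelZero C Ω A msq a ha f)
    (fun p q => hker_precOpA_levelZero C Ω A msq a hK ha hmsq.le hδ.le p q) Λ hp hq

end LevelZero

/-! ## §6 (2.37)–(2.38) at level `0` for `Ω ⊂ Ω₀`, unconditionally

At level `0`, `Δ^{(0),ε}(Ω₀, A) − Δ^{(0),ε}(Ω, A) = −Δ^{ε,N}_{A,Ω₀} + Δ^{ε,N}_{A,Ω}` consists of the bonds of `Ω₀` with an end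
outside `Ω`: its kernel lives within distance `1` of `Ωᶜ`, so the localisation input (5.5) of [B4] p. 594 holds with the
boundary weight `dist(·, Ωᶜ)` and `B1Ineq234Concrete.ineq238_concrete` applies. -/

section Geometry

/-- The distance (1.3) is symmetric. [cite: Balaban1982Higgs1, (1.3) p.604] -/
theorem tdist_comm (x y : HiggsLattice.Site P k) : HiggsLattice.Site.tdist x y = HiggsLattice.Site.tdist y x := by
  unfold HiggsLattice.Site.tdist
  congr 1
  funext μ
  rw [min_comm]

/-- The distance (1.3) satisfies the triangle inequality (the engine's `B4Sect5Torus.tdist_triangle` through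
`B1Ineq234Concrete.sdist_eq_tdist`). [cite: Balaban1982Higgs1, (1.3) p.604] -/
theorem tdist_triangle_real (x y z : HiggsLattice.Site P k) :
    (HiggsLattice.Site.tdist x z : ℝ) ≤ (HiggsLattice.Site.tdist x y : ℝ) + (HiggsLattice.Site.tdist y z : ℝ) := by
  rw [← sdist_eq_tdist, ← sdist_eq_tdist, ← sdist_eq_tdist]
  exact B4Sect5Torus.tdist_triangle (one_le_periods P k) _ _ _

/-- **`dist(·, Λᶜ)` is `1`-Lipschitz for (1.3)**: `dist(x, Λᶜ) ≤ |x − y| + dist(y, Λᶜ)` — the boundary-weight hypothesis of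
[B4] (5.9)/(5.10). [cite: Balaban1982Higgs1, (2.36) p.612] -/
theorem distC_le_tdist_add (Λ : Finset (HiggsLattice.Site P k)) (x y : HiggsLattice.Site P k) :
    distC Λ x ≤ (HiggsLattice.Site.tdist x y : ℝ) + distC Λ y := by
  by_cases h : (Λᶜ).Nonempty
  · obtain ⟨z, hz, hzmin⟩ := Finset.exists_mem_eq_inf' h (fun w => (HiggsLattice.Site.tdist y w : ℝ))
    have hy : distC Λ y = (HiggsLattice.Site.tdist y z : ℝ) := by
      unfold distC
      rw [dif_pos h]
      exact hzmin
    have hz' : z ∉ Λ := Finset.mem_compl.mp hz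
    calc distC Λ x ≤ (HiggsLattice.Site.tdist x z : ℝ) := distC_le Λ x hz'
      _ ≤ (HiggsLattice.Site.tdist x y : ℝ) + (HiggsLattice.Site.tdist y z : ℝ) := tdist_triangle_real x y z
      _ = (HiggsLattice.Site.tdist x y : ℝ) + distC Λ y := by rw [hy]
  · have hx : distC Λ x = 0 := by
      unfold distC
      rw [dif_neg h]
    rw [hx]
    exact add_nonneg (Nat.cast_nonneg _) (distC_nonneg Λ y)

/-- A site at distance `> 1` from `Ωᶜ` lies in `Ω` together with all its neighbours. [cite: Balaban1982Higgs1, (1.3) p.604] -/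
theorem interior_of_distC_gt_one {Ω : Finset (HiggsLattice.Site P k)} {x : HiggsLattice.Site P k} (h : 1 < distC Ω x) :
    x ∈ Ω ∧ (∀ μ, x.shift μ ∈ Ω) ∧ (∀ μ, x.unshift μ ∈ Ω) := by
  refine ⟨?_, fun μ => ?_, fun μ => ?_⟩ <;> by_contra hc
  · have h1 := distC_le Ω x hc
    rw [tdist_self, Nat.cast_zero] at h1
    linarith
  · have h1 := distC_le Ω x hc
    have h2 : (HiggsLattice.Site.tdist x (x.shift μ) : ℝ) ≤ 1 := by exact_mod_cast tdist_shift_le_one x μ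
    linarith
  · have h1 := distC_le Ω x hc
    have h2 : (HiggsLattice.Site.tdist x (x.unshift μ) : ℝ) ≤ 1 := by exact_mod_cast tdist_unshift_le_one x μ
    linarith

end Geometry

section Difference

variable (C : ChargeData N) (A : HiggsLattice.VecField P k) {Ω Ω₀ : Finset (HiggsLattice.Site P k)}

/-- At an interior site of `Ω ⊂ Ω₀` the forward terms of the two Neumann Laplacians agree. [cite: Balaban1982Higgs1, (1.11) p.605] -/
theorem fwdTerm_eq_of_interior (hΩ : Ω ⊆ Ω₀) {x : HiggsLattice.Site P k} {μ : Fin P.d} (hx : x ∈ Ω) (hμ : x.shift μ ∈ Ω) :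
    fwdTerm C Ω₀ A x μ = fwdTerm C Ω A x μ := by
  unfold fwdTerm
  rw [if_pos ⟨hΩ hx, hΩ hμ⟩, if_pos ⟨hx, hμ⟩]

/-- … and so do the backward terms. [cite: Balaban1982Higgs1, (1.11) p.605] -/
theorem bwdTerm_eq_of_interior (hΩ : Ω ⊆ Ω₀) {x : HiggsLattice.Site P k} {μ : Fin P.d} (hx : x ∈ Ω)
    (hμ : x.unshift μ ∈ Ω) : bwdTerm C Ω₀ A x μ = bwdTerm C Ω A x μ := by
  unfold bwdTerm
  rw [if_pos ⟨hΩ hx, hΩ hμ⟩, if_pos ⟨hx, hμ⟩]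

/-- **`(−Δ^{η,N}_{A,Ω₀}φ)(x) = (−Δ^{η,N}_{A,Ω}φ)(x)` at every interior site `x` of `Ω ⊂ Ω₀`** (all `2d` neighbours in `Ω`).
[cite: Balaban1982Higgs1, (1.11) p.605] -/
theorem covLaplacianN_apply_eq_of_interior (hΩ : Ω ⊆ Ω₀) {x : HiggsLattice.Site P k} (hx : x ∈ Ω)
    (hs : ∀ μ, x.shift μ ∈ Ω) (hu : ∀ μ, x.unshift μ ∈ Ω) (φ : ScalarField P k N) :
    covLaplacianN C Ω₀ A φ x = covLaplacianN C Ω A φ x := by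
  rw [covLaplacianN_apply, covLaplacianN_apply]
  congr 1
  exact Finset.sum_congr rfl fun μ _ => by
    rw [fwdTerm_eq_of_interior C A hΩ hx (hs μ), bwdTerm_eq_of_interior C A hΩ hx (hu μ)]

end Difference

section LevelZeroPair

variable (C : ChargeData N) {Ω Ω₀ : Finset (HiggsLattice.Site P 0)} (A : HiggsLattice.VecField P 0) (msq a : ℝ)

/-- The kernel of `Δ^{(0),ε}(Ω,A)` is symmetric. [cite: Balaban1982Higgs1, (2.17) p.610] -/
theorem mat_deltaKA_zero_symm (Ω : Finset (HiggsLattice.Site P 0)) (p q : HiggsLattice.Site P 0 × Ix N) :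
    mat (deltaKA C Ω A msq a 0) q p = mat (deltaKA C Ω A msq a 0) p q :=
  (mat_isSymm (siteInner_deltaKA_comm C Ω A msq a 0)).apply p q

/-- **The difference kernel vanishes in the interior**: `(Δ^{(0)}(Ω₀,A) − Δ^{(0)}(Ω,A))(p, q) = 0` if `dist(x_p, Ωᶜ) > 1`
(`Ω ⊂ Ω₀`). [cite: Balaban1983RegularityDecay, (5.5) p.594] -/
theorem mat_deltaKA_zero_sub_eq_zero_of_interior (hΩ : Ω ⊆ Ω₀) {p q : HiggsLattice.Site P 0 × Ix N}
    (h : 1 < distC Ω p.1) :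
    mat (deltaKA C Ω₀ A msq a 0) p q - mat (deltaKA C Ω A msq a 0) p q = 0 := by
  obtain ⟨hx, hs, hu⟩ := interior_of_distC_gt_one h
  rw [mat_apply, mat_apply, fieldCoord_apply, fieldCoord_apply, deltaKA_zero, deltaKA_zero, delta0, delta0,
    LinearMap.add_apply, LinearMap.add_apply, Pi.add_apply, Pi.add_apply,
    covLaplacianN_apply_eq_of_interior C A hΩ hx hs hu, sub_self]

/-- **(5.5) at level `0` for `Ω ⊂ Ω₀`, every `A`, every rate `δ ≥ 0`**: `|(Δ^{(0)}(Ω₀,A) − Δ^{(0)}(Ω,A))(p, q)| ≤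
2(4dε^{−2} + m²)e^{3δ}·e^{−δ(|x_p − x_q| + dist(x_p,Ωᶜ) + dist(x_q,Ωᶜ))}` (`m² ≥ 0`): the difference is supported on
pairs within distance `1` of each other and of `Ωᶜ`. [cite: Balaban1983RegularityDecay, (5.5) p.594] -/
theorem abs_mat_deltaKA_zero_sub_le (hΩ : Ω ⊆ Ω₀) (hmsq : 0 ≤ msq) {δ : ℝ} (hδ : 0 ≤ δ)
    (p q : HiggsLattice.Site P 0 × Ix N) :
    |mat (deltaKA C Ω₀ A msq a 0) p q - mat (deltaKA C Ω A msq a 0) p q| ≤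
      2 * (4 * P.d * (P.mesh 0)⁻¹ ^ 2 + msq) * Real.exp (3 * δ) *
        Real.exp (-(δ * ((HiggsLattice.Site.tdist p.1 q.1 : ℝ) + distC Ω p.1 + distC Ω q.1))) := by
  have hB : 0 ≤ 4 * (P.d : ℝ) * (P.mesh 0)⁻¹ ^ 2 + msq := by positivity
  have hpos : 0 ≤ 2 * (4 * P.d * (P.mesh 0)⁻¹ ^ 2 + msq) * Real.exp (3 * δ) *
      Real.exp (-(δ * ((HiggsLattice.Site.tdist p.1 q.1 : ℝ) + distC Ω p.1 + distC Ω q.1))) := by positivity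
  by_cases ht : HiggsLattice.Site.tdist p.1 q.1 ≤ 1
  · by_cases hp : distC Ω p.1 ≤ 1
    · by_cases hq : distC Ω q.1 ≤ 1
      · have h1 := abs_mat_deltaKA_zero_le_const C Ω₀ A msq a hmsq p q
        have h2 := abs_mat_deltaKA_zero_le_const C Ω A msq a hmsq p q
        have hsum : |mat (deltaKA C Ω₀ A msq a 0) p q - mat (deltaKA C Ω A msq a 0) p q|
            ≤ 2 * (4 * P.d * (P.mesh 0)⁻¹ ^ 2 + msq) := (abs_sub _ _).trans (by linarith)
        have ht' : (HiggsLattice.Site.tdist p.1 q.1 : ℝ) ≤ 1 := by exact_mod_cast ht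
        have hexp : 1 ≤ Real.exp (3 * δ) *
            Real.exp (-(δ * ((HiggsLattice.Site.tdist p.1 q.1 : ℝ) + distC Ω p.1 + distC Ω q.1))) := by
          rw [← Real.exp_add]
          refine Real.one_le_exp ?_
          have : 0 ≤ δ * (3 - ((HiggsLattice.Site.tdist p.1 q.1 : ℝ) + distC Ω p.1 + distC Ω q.1)) :=
            mul_nonneg hδ (by linarith)
          linarith
        calc |mat (deltaKA C Ω₀ A msq a 0) p q - mat (deltaKA C Ω A msq a 0) p q|
            ≤ 2 * (4 * P.d * (P.mesh 0)⁻¹ ^ 2 + msq) := hsum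
          _ = 2 * (4 * P.d * (P.mesh 0)⁻¹ ^ 2 + msq) * 1 := (mul_one _).symm
          _ ≤ 2 * (4 * P.d * (P.mesh 0)⁻¹ ^ 2 + msq) * (Real.exp (3 * δ) *
                Real.exp (-(δ * ((HiggsLattice.Site.tdist p.1 q.1 : ℝ) + distC Ω p.1 + distC Ω q.1)))) :=
              mul_le_mul_of_nonneg_left hexp (by positivity)
          _ = _ := by ring
      · rw [← mat_deltaKA_zero_symm C A msq a Ω₀ p q, ← mat_deltaKA_zero_symm C A msq a Ω p q,
          mat_deltaKA_zero_sub_eq_zero_of_interior C A msq a hΩ (not_le.mp hq), abs_zero]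
        exact hpos
    · rw [mat_deltaKA_zero_sub_eq_zero_of_interior C A msq a hΩ (not_le.mp hp), abs_zero]
      exact hpos
  · rw [mat_deltaKA_zero_eq_zero C Ω₀ A msq a (not_le.mp ht), mat_deltaKA_zero_eq_zero C Ω A msq a (not_le.mp ht),
      sub_self, abs_zero]
    exact hpos

/-- The common constant of §6 dominates the (5.4) constant. [cite: Balaban1983RegularityDecay, (5.4) p.594] -/
theorem kerConst_le_pairConst (hmsq : 0 ≤ msq) (δ : ℝ) :
    a * ((P.mesh (0 + 1))⁻¹ ^ 2) * Real.exp (δ * ((P.L : ℝ) - 1)) + (4 * P.d * (P.mesh 0)⁻¹ ^ 2 + msq) * Real.exp δ ≤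
      a * ((P.mesh (0 + 1))⁻¹ ^ 2) * Real.exp (δ * ((P.L : ℝ) - 1)) +
        (4 * P.d * (P.mesh 0)⁻¹ ^ 2 + msq) * (Real.exp δ + 2 * Real.exp (3 * δ)) := by
  have hB : 0 ≤ 4 * (P.d : ℝ) * (P.mesh 0)⁻¹ ^ 2 + msq := by positivity
  nlinarith [Real.exp_pos (3 * δ)]

/-- … and the (5.5) constant. [cite: Balaban1983RegularityDecay, (5.5) p.594] -/
theorem locConst_le_pairConst (ha : 0 ≤ a) (hmsq : 0 ≤ msq) (δ : ℝ) :
    2 * (4 * P.d * (P.mesh 0)⁻¹ ^ 2 + msq) * Real.exp (3 * δ) ≤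
      a * ((P.mesh (0 + 1))⁻¹ ^ 2) * Real.exp (δ * ((P.L : ℝ) - 1)) +
        (4 * P.d * (P.mesh 0)⁻¹ ^ 2 + msq) * (Real.exp δ + 2 * Real.exp (3 * δ)) := by
  have hB : 0 ≤ 4 * (P.d : ℝ) * (P.mesh 0)⁻¹ ^ 2 + msq := by positivity
  have h1 : 0 ≤ a * ((P.mesh (0 + 1))⁻¹ ^ 2) * Real.exp (δ * ((P.L : ℝ) - 1)) :=
    mul_nonneg (mul_nonneg ha (sq_nonneg _)) (Real.exp_pos _).le
  nlinarith [Real.exp_pos δ]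

/-- **(2.38) AT LEVEL `0` for `Ω ⊂ Ω₀`, PROVED FOR EVERY `A`, `Λ`** — *"for Ω ⊂ Ω₀ and δC^{(k)}_Λ(Ω, Ω₀, A) =
C^{(k)}_Λ(Ω, A) − C^{(k)}_Λ(Ω₀, A), (2.37) we have similarly |δC^{(k)}_Λ(Ω, Ω₀, A; x, x′)| ≦ c₀ exp(−δ₀(|x − x′| +
dist(x, Ω^{(k)c}) + dist(x′, Ω^{(k)c}))), x, x′ ∈ Λ. (2.38)"*: for `m² > 0`, `a ≥ 0`, `0 < K`, every rate parameter
`δ > 0`, every external field `A`, every `Λ` and `p, q` with sites in `Λ`,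
`|(C^{(0),ε}_Λ(Ω,A) − C^{(0),ε}_Λ(Ω₀,A))(p, q)| ≤ c₁e^{−δ₁(|x_p − x_q| + dist(x_p,Ωᶜ) + dist(x_q,Ωᶜ))}`,
`(c₁, δ₁) = (cSt, dSt)(N·K_d; m², c(δ), δ)`, `c(δ) = a(Lε)^{−2}e^{δ(L−1)} + (4dε^{−2} + m²)(e^{δ} + 2e^{3δ})`.
[cite: Balaban1982Higgs1, Prop. 2.3 (2.37)–(2.38) p.612] -/
theorem ineq238_levelZero (hΩ : Ω ⊆ Ω₀) (hK : 0 < P.K) (ha : 0 ≤ a) (hmsq : 0 < msq) {δ : ℝ} (hδ : 0 < δ)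
    (Λ : Finset (HiggsLattice.Site P 0)) {p q : HiggsLattice.Site P 0 × Ix N} (hp : p.1 ∈ Λ) (hq : q.1 ∈ Λ) :
    |mat (condCov232 C Ω A msq a 0 Λ) p q - mat (condCov232 C Ω₀ A msq a 0 Λ) p q| ≤
      cSt (profile P N) msq
          (a * ((P.mesh (0 + 1))⁻¹ ^ 2) * Real.exp (δ * ((P.L : ℝ) - 1)) +
            (4 * P.d * (P.mesh 0)⁻¹ ^ 2 + msq) * (Real.exp δ + 2 * Real.exp (3 * δ))) δ *
        Real.exp (-(dSt (profile P N) msq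
          (a * ((P.mesh (0 + 1))⁻¹ ^ 2) * Real.exp (δ * ((P.L : ℝ) - 1)) +
            (4 * P.d * (P.mesh 0)⁻¹ ^ 2 + msq) * (Real.exp δ + 2 * Real.exp (3 * δ))) δ *
          ((HiggsLattice.Site.tdist p.1 q.1 : ℝ) + distC Ω p.1 + distC Ω q.1))) := by
  have hc1 := kerConst_le_pairConst (P := P) msq a hmsq.le δ
  have hc2 := locConst_le_pairConst (P := P) msq a ha hmsq.le δ
  have hcpos : 0 < a * ((P.mesh (0 + 1))⁻¹ ^ 2) * Real.exp (δ * ((P.L : ℝ) - 1)) +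
      (4 * P.d * (P.mesh 0)⁻¹ ^ 2 + msq) * (Real.exp δ + 2 * Real.exp (3 * δ)) :=
    lt_of_lt_of_le (kerConst_levelZero_pos msq a ha hmsq δ) hc1
  refine ineq238_concrete C Ω A msq a Ω₀ hmsq hcpos hδ
    (fun f => lower_precOpA_levelZero C Ω A msq a ha f)
    (fun p q => (hker_precOpA_levelZero C Ω A msq a hK ha hmsq.le hδ.le p q).trans
      (mul_le_mul_of_nonneg_right hc1 (Real.exp_pos _).le))
    (fun f => lower_precOpA_levelZero C Ω₀ A msq a ha f)
    (fun p q => (hker_precOpA_levelZero C Ω₀ A msq a hK ha hmsq.le hδ.le p q).trans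
      (mul_le_mul_of_nonneg_right hc1 (Real.exp_pos _).le))
    (fun x => distC_nonneg Ω x) (fun x y => distC_le_tdist_add Ω x y)
    (fun p q => (abs_mat_deltaKA_zero_sub_le C A msq a hΩ hmsq.le hδ.le p q).trans
      (mul_le_mul_of_nonneg_right hc2 (Real.exp_pos _).le))
    Λ hp hq

end LevelZeroPair

end Literature.MathematicalPhysics.QuantumFieldTheory.Balaban1983to89.B1Ineq234LevelZero
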